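import Summits.QuantumFields.YangMills.Theorems.BalabanUVNodesN19LacunaryTestSeries

/-!
# YM-DAG node N19 (= NE7 proper) — ONE FIXED LIPSCHITZ OBSERVABLE WHOSE EXPECTATIONS DO NOT CONVERGE ABSOLUTELY UNDER N19's TARGET
# (geometric remainders; a lacunary series of Chebyshev-arc test polynomials read along an arc chain with exponentially long blocks)

Cell `pub-ymgap`, HUMAN RULING D-0062 (Track A) ∕ D-0149 (work-bound push), R141 (C) wider-strategy seat `pub-ymgap-dag-n19-e` (strategy s3 =
ALTERNATIVE CURRENCY), generation g23, module 6 (lineage module 83).  Route `Summits/QuantumFields/YangMills/Theses/BalabanUVNodes.lean` rev 25,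
cluster item K3⁷ «SpineGivenEndpointR13SepCoPH» (stmt-QuantumFields-20544); filed `--supports` that item `--as helper` (it proves no registered
stub).  COUNT-NEUTRAL: [folklore] over Mathlib (`Nat.rec`, `Nat.find`, `Polynomial.eval_eq_sum_range'`, `Polynomial.Chebyshev.natDegree_T`) + the lineage
BY NAME — module 82 `…N19LacunaryTestSeries` (the series test, the lacunary lower bound, affordability), modules 71 ∕ 72 `…N19ChebyshevArcFunctional` ∕
`…N19ChebyshevArcLaws` (arcs, `alt_sum_integral_powSum_eq_zero`, `abs_alt_sum_integral_exp_le`, the test polynomial and its exact payment), module 64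
(`abs_log_sub_log_le_of_exp_neg_le`, `exp_neg_le_mgf_id_of_Icc_symm`), p555512 (`abs_integral_le_of_Icc_symm`); `Spine.NE7.Target` (N19's DECL-target
SHAPE) is CONCLUDED for an explicit TOY family; no scheme object, no Theses import; NOT a discharge claim.

THE RESULT ★★★ `exists_target_geometric_fixedTest_not_summable`: for every `l₀ > 0`, `vol > 0`, `C > 0` and `0 < θ < 1` there are probability laws `λ_K`
on `[−1,1]` with `Spine.NE7.Target vol l₀ (K ↦ Cθ^K) (K t ↦ mgf λ_K t)` — N19's DECL-target SHAPE at the programme's geometric remainder, summability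
included — and ONE continuous observable `g`, `1`-Lipschitz and `1`-bounded on `[−1,1]`, such that `Σ_K |∫g dλ_{K+1} − ∫g dλ_K| = ∞`: the expectations
`E_K g` converge (p505344 ∕ p546312: every bounded-Lipschitz observable does) but NOT absolutely.  Module 81 gave total variation `N` for every `N` with
`N`-dependent data; here ONE pair `(λ, g)` does it, which needs infinitely many levels seen by one test.

THE CONSTRUCTION.  Levels `m_0 < m_1 < …` (`m_{i+1} ≥ m_i + 3`, `m_0 ≥ max(3, ⌈2l₀⌉)`) and block ends `T_0 = 0`, `T_{i+1} = T_i + 3·8^{i+1}·m_i` are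
built by recursion (`Nat.rec` on pairs) with module 82's affordability lemma: the level-`m_i` step cost `4e^{l₀}l₀^{m_i−1}∕(m_i−1)!` is `≤ vol·C·θ^{T_{i+1}}`,
so level `m_i` is affordable during the whole block `[T_i, T_{i+1})`.  The chain: `λ_K = P_{m_i}` (`K` even) ∕ `Q_{m_i}` (`K` odd) for `K` in block
`i` (`i = ι(K)` by `Nat.find`), module 72's complementary Chebyshev-arc laws; every step costs `≤ 4e^{l₀}b_{m_{ι(K)}} ≤ vol·Cθ^K` on the window (both
laws of a step are within `2b` of the uniform base in mgf; `b` is antitone in the level; `K < T_{ι(K)+1}`), so `MatchingModConstants vol l₀ (Cθ^K)` holds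
with constants `0`, and `ΣCθ^K < ∞` gives `Target`.  The observable: `g(x) = Σ_j 8^{−(j+1)}·g_{m_j}(clamp x)`, `g_n = (T_{n−1} − T_{n+1})∕(4n)` module
72's test polynomial (continuous, `(1∕7)`-Lipschitz, `(1∕7)`-bounded by module 82).  Inside block `i` a step swaps `P_{m_i} ↔ Q_{m_i}` and
`∫g dP_{m_i} − ∫g dQ_{m_i} = Σ_j 8^{−(j+1)} a_j` with `a_j = Σ_k(−1)^k∫_{arc k} g_{m_j}`: `a_j = 0` for `j < i` (a polynomial of degree `m_j + 1 ≤ m_i − 2`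
is killed by the alternating arc functional, module 71), `a_i = 1∕(2m_i)` EXACTLY (module 72), `|a_j| ≤ 1∕m_j ≤ 1∕m_i` for `j > i`; module 82's lacunary
bound gives `≥ 8^{−(i+1)}∕(3m_i)` per step, so block `i` (with `3·8^{i+1}m_i − 1` inner steps) contributes `≥ 1 − 8^{−(i+1)}∕(3m_i) ≥ ½`, and the partial
sums over `[0, T_n)` are `≥ n∕2` — not summable.

HONEST FRAMING (binding).  Elementary and [folklore]; TOY laws; NO consumer in the DAG today (a structural statement about the seat's own currencies);
nothing of Bałaban's instantiated; NE7 NOT PRINTED, NOT proved; N19 NOT discharged; count-neutral.  One finite `T⁴` programme at fixed `ε`; nothing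
continuum ∕ `ℝ⁴` ∕ OS ∕ mass-gap ∕ Clay.  0 `def` ∕ 0 `sorry`.
-/

noncomputable section

open Real Finset MeasureTheory ProbabilityTheory Polynomial Polynomial.Chebyshev

namespace Summit.QuantumFields.YangMills.Theorems.BalabanUVNodesN19TargetFixedTestNotSummable

open Literature.MathematicalPhysics.QuantumFieldTheory.Balaban1983to89
open T4CauchySum (MatchingModConstants)
open Summit.QuantumFields.BalabanUV.T4Continuum.Spine
open Summit.QuantumFields.YangMills.Theorems.BalabanUVNodesN19LawIncrementsTarget (abs_log_sub_log_le_of_exp_neg_le exp_neg_le_mgf_id_of_Icc_symm)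
open Summit.QuantumFields.YangMills.Theorems.BalabanUVNodesN19LawPriceTwoSided (abs_integral_le_of_Icc_symm)
open Summit.QuantumFields.YangMills.Theorems.BalabanUVNodesN19ChebyshevArcFunctional
  (node_succ_lt sum_arcLength_even_odd alt_sum_integral_powSum_eq_zero abs_alt_sum_integral_exp_le)
open Summit.QuantumFields.YangMills.Theorems.BalabanUVNodesN19ChebyshevArcLaws
  (arcMeasure_apply_univ arcMeasure_Icc_compl integral_arcMeasure alt_sum_eq_even_sub_odd sum_integral_arcs
    testPoly_lipschitz_bound alt_sum_integral_testPoly)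
open Summit.QuantumFields.YangMills.Theorems.BalabanUVNodesN19LacunaryTestSeries
  (summable_weights continuous_seriesTest abs_seriesTest_le abs_seriesTest_sub_le integral_seriesTest lacunary_lower_bound exists_level_affordable)

/-! ## §1 The test polynomial as a power sum, killed by finer arc functionals [folklore] -/

/-- The level-`n` test polynomial `(T_{n−1} − T_{n+1})∕(4n)` is a power sum of degree `≤ n + 1`. [folklore] -/
theorem testPoly_eq_powSum {n : ℕ} (hn : 1 ≤ n) :
    ∃ c : ℕ → ℝ, ∀ x : ℝ, ((T ℝ ((n : ℤ) - 1)).eval x - (T ℝ ((n : ℤ) + 1)).eval x) / (4 * n) = ∑ j ∈ range (n + 2), c j * x ^ j := by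
  set p : ℝ[X] := T ℝ ((n : ℤ) - 1) - T ℝ ((n : ℤ) + 1) with hp
  have hdeg : p.natDegree < n + 2 := by
    have h1 : (T ℝ ((n : ℤ) - 1)).natDegree = ((n : ℤ) - 1).natAbs := natDegree_T ℝ _
    have h2 : (T ℝ ((n : ℤ) + 1)).natDegree = ((n : ℤ) + 1).natAbs := natDegree_T ℝ _
    have h := natDegree_sub_le (T ℝ ((n : ℤ) - 1)) (T ℝ ((n : ℤ) + 1))
    rw [h1, h2] at h
    rw [hp]
    omega
  refine ⟨fun j => p.coeff j / (4 * n), fun x => ?_⟩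
  rw [show (T ℝ ((n : ℤ) - 1)).eval x - (T ℝ ((n : ℤ) + 1)).eval x = p.eval x by rw [hp, eval_sub], eval_eq_sum_range' hdeg x,
    Finset.sum_div]
  exact Finset.sum_congr rfl fun j _ => by ring

/-- Hence the alternating arc functional of a FINER level `n' ≥ n + 3` kills the level-`n` test polynomial (module 71). [folklore] -/
theorem alt_sum_integral_testPoly_eq_zero_of_le {n n' : ℕ} (hn : 1 ≤ n) (hnn' : n + 3 ≤ n') :
    ∑ k ∈ range n', (-1 : ℝ) ^ k * ∫ x in node n' (k + 1)..node n' k,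
      ((T ℝ ((n : ℤ) - 1)).eval x - (T ℝ ((n : ℤ) + 1)).eval x) / (4 * n) = 0 := by
  obtain ⟨c, hc⟩ := testPoly_eq_powSum hn
  simp_rw [hc]
  exact alt_sum_integral_powSum_eq_zero (by omega) c

/-! ## §2 The theorem [folklore] -/

/-- ★★★ **ONE FIXED LIPSCHITZ OBSERVABLE WITH NON-SUMMABLE EXPECTATION INCREMENTS UNDER N19's TARGET (geometric remainders).**  For every `l₀ > 0`,
`vol > 0`, `C > 0`, `0 < θ < 1`: probability laws `λ_K` on `[−1,1]` with `Spine.NE7.Target vol l₀ (K ↦ Cθ^K) (K t ↦ mgf λ_K t)` and ONE continuous `g`,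
`1`-Lipschitz and `1`-bounded on `[−1,1]`, with `¬ Summable (K ↦ |∫g dλ_{K+1} − ∫g dλ_K|)` (header). [folklore] -/
theorem exists_target_geometric_fixedTest_not_summable {l₀ vol C θ : ℝ} (hl₀ : 0 < l₀) (hvol : 0 < vol) (hC : 0 < C)
    (hθ0 : 0 < θ) (hθ1 : θ < 1) :
    ∃ Λ : ℕ → Measure ℝ, (∀ K, IsProbabilityMeasure (Λ K)) ∧ (∀ K, Λ K (Set.Icc (-1 : ℝ) 1)ᶜ = 0) ∧
      NE7.Target vol l₀ (fun K => C * θ ^ K) (fun K t => mgf id (Λ K) t) ∧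
      ∃ g : ℝ → ℝ, Continuous g ∧
        (∀ x y : ℝ, x ∈ Set.Icc (-1 : ℝ) 1 → y ∈ Set.Icc (-1 : ℝ) 1 → |g x - g y| ≤ 1 * |x - y|) ∧
        (∀ x : ℝ, x ∈ Set.Icc (-1 : ℝ) 1 → |g x| ≤ 1) ∧
        ¬ Summable (fun K => |∫ x, g x ∂Λ (K + 1) - ∫ x, g x ∂Λ K|) := by
  classical
  /- §A the explicit complementary Chebyshev-arc laws and test polynomials at every level -/
  set Pa : ℕ → Measure ℝ := fun n => ∑ k ∈ (range n).filter (fun k => Even k),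
    (volume : Measure ℝ).restrict (Set.Ioc (node n (k + 1)) (node n k)) with hPa
  set Qa : ℕ → Measure ℝ := fun n => ∑ k ∈ (range n).filter (fun k => ¬ Even k),
    (volume : Measure ℝ).restrict (Set.Ioc (node n (k + 1)) (node n k)) with hQa
  set Gt : ℕ → ℝ → ℝ := fun n x => ((T ℝ ((n : ℤ) - 1)).eval x - (T ℝ ((n : ℤ) + 1)).eval x) / (4 * n) with hGt
  have hE : ∀ n, (range n).filter (fun k => Even k) ⊆ range n := fun n => Finset.filter_subset _ _
  have hO : ∀ n, (range n).filter (fun k => ¬ Even k) ⊆ range n := fun n => Finset.filter_subset _ _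
  have iPa : ∀ n, 3 ≤ n → IsProbabilityMeasure (Pa n) := fun n hn =>
    ⟨by rw [hPa]; dsimp only; rw [arcMeasure_apply_univ n (hE n), (sum_arcLength_even_odd (n := n) (by omega)).1, ENNReal.ofReal_one]⟩
  have iQa : ∀ n, 3 ≤ n → IsProbabilityMeasure (Qa n) := fun n hn =>
    ⟨by rw [hQa]; dsimp only; rw [arcMeasure_apply_univ n (hO n), (sum_arcLength_even_odd (n := n) (by omega)).2, ENNReal.ofReal_one]⟩
  have hPac : ∀ n, Pa n (Set.Icc (-1 : ℝ) 1)ᶜ = 0 := fun n => by rw [hPa]; exact arcMeasure_Icc_compl n _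
  have hQac : ∀ n, Qa n (Set.Icc (-1 : ℝ) 1)ᶜ = 0 := fun n => by rw [hQa]; exact arcMeasure_Icc_compl n _
  have hsub : ∀ (n : ℕ) {f : ℝ → ℝ}, Continuous f →
      ∫ x, f x ∂Pa n - ∫ x, f x ∂Qa n = ∑ k ∈ range n, (-1 : ℝ) ^ k * ∫ x in node n (k + 1)..node n k, f x := fun n f hf => by
    rw [hPa, hQa]; dsimp only; rw [integral_arcMeasure n (hE n) hf, integral_arcMeasure n (hO n) hf, alt_sum_eq_even_sub_odd]
  have hadd : ∀ (n : ℕ), n ≠ 0 → ∀ {f : ℝ → ℝ}, Continuous f → ∫ x, f x ∂Pa n + ∫ x, f x ∂Qa n = ∫ x in (-1 : ℝ)..1, f x :=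
    fun n hn f hf => by
    rw [hPa, hQa]; dsimp only
    rw [integral_arcMeasure n (hE n) hf, integral_arcMeasure n (hO n) hf, Finset.sum_filter_add_sum_filter_not, sum_integral_arcs hn hf]
  have hGc : ∀ n, Continuous (Gt n) := fun n => ((Polynomial.continuous _).sub (Polynomial.continuous _)).div_const _
  have hGL : ∀ n, 1 ≤ n → ∀ x y : ℝ, x ∈ Set.Icc (-1 : ℝ) 1 → y ∈ Set.Icc (-1 : ℝ) 1 → |Gt n x - Gt n y| ≤ 1 * |x - y| :=
    fun n hn => (testPoly_lipschitz_bound hn).1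
  have hGB : ∀ n, 1 ≤ n → ∀ x : ℝ, x ∈ Set.Icc (-1 : ℝ) 1 → |Gt n x| ≤ 1 / (2 * n) := fun n hn => (testPoly_lipschitz_bound hn).2
  have hGpay : ∀ n, 3 ≤ n → ∫ x, Gt n x ∂Pa n - ∫ x, Gt n x ∂Qa n = 1 / (2 * n) := fun n hn => by
    rw [hsub n (hGc n)]; exact alt_sum_integral_testPoly hn
  have hGkill : ∀ n n', 1 ≤ n → n + 3 ≤ n' → ∫ x, Gt n x ∂Pa n' - ∫ x, Gt n x ∂Qa n' = 0 := fun n n' hn hnn' => by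
    rw [hsub n' (hGc n)]; exact alt_sum_integral_testPoly_eq_zero_of_le hn hnn'
  -- the window remainder `b n = l₀^{n−1}∕(n−1)!`: antitone from `l₀ ≤ n` on, and the mgfs are within `2 b n` of the uniform base
  set b : ℕ → ℝ := fun n => l₀ ^ (n - 1) / ((n - 1).factorial : ℝ) with hb
  have hb_step : ∀ n : ℕ, 1 ≤ n → l₀ ≤ (n : ℝ) → b (n + 1) ≤ b n := fun n hn hln => by
    rw [hb]; dsimp only
    have e : n + 1 - 1 = (n - 1) + 1 := by omega
    rw [e, pow_succ, Nat.factorial_succ, Nat.cast_mul, div_le_div_iff₀ (by positivity) (by positivity)]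
    have hcast : ((n - 1 : ℕ) : ℝ) + 1 = n := by rw [Nat.cast_sub hn]; push_cast; ring
    have hf : (0 : ℝ) < (n - 1).factorial := by positivity
    have hp : (0 : ℝ) ≤ l₀ ^ (n - 1) := by positivity
    push_cast
    rw [hcast]
    nlinarith [mul_le_mul_of_nonneg_left hln (mul_nonneg hp hf.le)]
  have hmgf : ∀ n : ℕ, 3 ≤ n → 2 * l₀ ≤ (n : ℝ) → ∀ t : ℝ, |t| ≤ l₀ →
      |mgf id (Pa n) t - 1 / 2 * ∫ x in (-1 : ℝ)..1, Real.exp (t * x)| ≤ 2 * b n ∧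
      |mgf id (Qa n) t - 1 / 2 * ∫ x in (-1 : ℝ)..1, Real.exp (t * x)| ≤ 2 * b n := by
    intro n hn hnl t ht
    have hc : Continuous fun x : ℝ => Real.exp (t * x) := Real.continuous_exp.comp (continuous_const.mul continuous_id)
    have h1 := hsub n hc
    have h2 := hadd n (by omega) hc
    have hA := abs_alt_sum_integral_exp_le (n := n) (by omega) hnl ht
    rw [← h1] at hA
    have hmP : mgf id (Pa n) t = ∫ x, Real.exp (t * x) ∂Pa n := by simp only [mgf, id]
    have hmQ : mgf id (Qa n) t = ∫ x, Real.exp (t * x) ∂Qa n := by simp only [mgf, id]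
    rw [hmP, hmQ]
    constructor
    · rw [show ∫ x, Real.exp (t * x) ∂Pa n - 1 / 2 * ∫ x in (-1 : ℝ)..1, Real.exp (t * x) =
          (1 / 2) * (∫ x, Real.exp (t * x) ∂Pa n - ∫ x, Real.exp (t * x) ∂Qa n) by rw [← h2]; ring,
        abs_mul, abs_of_pos (by norm_num : (0 : ℝ) < 1 / 2)]
      linarith
    · rw [show ∫ x, Real.exp (t * x) ∂Qa n - 1 / 2 * ∫ x in (-1 : ℝ)..1, Real.exp (t * x) =
          -((1 / 2) * (∫ x, Real.exp (t * x) ∂Pa n - ∫ x, Real.exp (t * x) ∂Qa n)) by rw [← h2]; ring,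
        abs_neg, abs_mul, abs_of_pos (by norm_num : (0 : ℝ) < 1 / 2)]
      linarith
  /- §B levels `m_i` and block ends `T_i` by recursion, with module 82's affordability -/
  set N₀ : ℕ := max 3 ⌈2 * l₀⌉₊ with hN₀
  have hN3 : 3 ≤ N₀ := le_max_left _ _
  have hNl : 2 * l₀ ≤ N₀ := (Nat.le_ceil _).trans (by exact_mod_cast le_max_right 3 ⌈2 * l₀⌉₊)
  have hex : ∀ (A B M : ℕ), 1 ≤ A → ∃ m : ℕ, M ≤ m ∧ 4 * Real.exp l₀ * (l₀ ^ (m - 1) / ((m - 1).factorial : ℝ)) ≤ vol * C * θ ^ (B + A * m) :=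
    fun A B M hA => exists_level_affordable hl₀.le (mul_pos hvol hC) hθ0 hθ1 hA B M
  have hA1 : ∀ i : ℕ, 1 ≤ 3 * 8 ^ i := fun i => Nat.succ_le_of_lt (by positivity)
  let step : ℕ → ℕ × ℕ → ℕ × ℕ := fun i p =>
    (Classical.choose (hex (3 * 8 ^ (i + 1 + 1)) (p.2 + 3 * 8 ^ (i + 1) * p.1) (p.1 + 3) (hA1 _)), p.2 + 3 * 8 ^ (i + 1) * p.1)
  let F : ℕ → ℕ × ℕ := fun i => Nat.rec (Classical.choose (hex (3 * 8 ^ (0 + 1)) 0 N₀ (hA1 _)), 0) step i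
  -- `m i = (F i).1`, `T i = (F i).2`
  have hF0 : F 0 = (Classical.choose (hex (3 * 8 ^ (0 + 1)) 0 N₀ (hA1 _)), 0) := rfl
  have hFs : ∀ i, F (i + 1) = step i (F i) := fun i => rfl
  have hT0 : (F 0).2 = 0 := by rw [hF0]
  have hTs : ∀ i, (F (i + 1)).2 = (F i).2 + 3 * 8 ^ (i + 1) * (F i).1 := fun i => by rw [hFs i]
  have hspec0 : N₀ ≤ (F 0).1 ∧ 4 * Real.exp l₀ * b (F 0).1 ≤ vol * C * θ ^ (0 + 3 * 8 ^ (0 + 1) * (F 0).1) := by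
    rw [hF0]; exact Classical.choose_spec (hex (3 * 8 ^ (0 + 1)) 0 N₀ (hA1 _))
  have hspecs : ∀ i, (F i).1 + 3 ≤ (F (i + 1)).1 ∧
      4 * Real.exp l₀ * b (F (i + 1)).1 ≤ vol * C * θ ^ ((F i).2 + 3 * 8 ^ (i + 1) * (F i).1 + 3 * 8 ^ (i + 1 + 1) * (F (i + 1)).1) :=
    fun i => by
    rw [hFs i]
    exact Classical.choose_spec (hex (3 * 8 ^ (i + 1 + 1)) ((F i).2 + 3 * 8 ^ (i + 1) * (F i).1) ((F i).1 + 3) (hA1 _))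
  -- the derived facts
  have hm_ge : ∀ i, N₀ ≤ (F i).1 := fun i => by
    induction i with
    | zero => exact hspec0.1
    | succ i ih => exact ih.trans ((Nat.le_add_right _ 3).trans (hspecs i).1)
  have hm3 : ∀ i, 3 ≤ (F i).1 := fun i => hN3.trans (hm_ge i)
  have hm1 : ∀ i, 1 ≤ (F i).1 := fun i => le_trans (by norm_num) (hm3 i)
  have hml : ∀ i, 2 * l₀ ≤ (F i).1 := fun i => hNl.trans (by exact_mod_cast hm_ge i)
  have hm_sep : ∀ i j, i < j → (F i).1 + 3 ≤ (F j).1 := fun i j hij => by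
    induction j with
    | zero => exact absurd hij (Nat.not_lt_zero _)
    | succ j ih =>
      rcases Nat.lt_succ_iff_lt_or_eq.1 hij with h | h
      · exact (ih h).trans ((Nat.le_add_right _ 3).trans (hspecs j).1)
      · rw [h]; exact (hspecs j).1
  have hm_mono : ∀ i j, i ≤ j → (F i).1 ≤ (F j).1 := fun i j hij => by
    rcases hij.lt_or_eq with h | h
    · exact (Nat.le_add_right _ 3).trans (hm_sep i j h)
    · rw [h]
  have hcost : ∀ i, 4 * Real.exp l₀ * b (F i).1 ≤ vol * C * θ ^ (F (i + 1)).2 := fun i => by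
    rcases i with _ | i
    · have h := hspec0.2
      rw [zero_add] at h
      rwa [hTs 0, hT0, zero_add]
    · rw [hTs (i + 1), hTs i]
      exact (hspecs i).2
  have hT_lt : ∀ i, (F i).2 < (F (i + 1)).2 := fun i => by
    rw [hTs i]
    have : 1 ≤ 3 * 8 ^ (i + 1) * (F i).1 := Nat.succ_le_of_lt (Nat.mul_pos (by positivity) (hm1 i))
    omega
  have hT_strict : StrictMono fun i => (F i).2 := strictMono_nat_of_lt_succ hT_lt
  have hi_le_T : ∀ i, i ≤ (F i).2 := fun i => hT_strict.le_apply
  -- `b` is antitone along the levels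
  have hb_mono : ∀ n n', N₀ ≤ n → n ≤ n' → b n' ≤ b n := by
    intro n n' hn hnn'
    induction n', hnn' using Nat.le_induction with
    | base => exact le_rfl
    | succ k hk ih =>
      have hk' : (N₀ : ℝ) ≤ k := by exact_mod_cast hn.trans hk
      exact (hb_step k (by omega) (by linarith)).trans ih
  /- §C the block index `ι K` -/
  have hexι : ∀ K : ℕ, ∃ i, K < (F (i + 1)).2 := fun K => ⟨K, Nat.lt_of_lt_of_le (Nat.lt_succ_self K) (hi_le_T (K + 1))⟩
  let ι : ℕ → ℕ := fun K => Nat.find (hexι K)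
  have hι_spec : ∀ K, K < (F (ι K + 1)).2 := fun K => Nat.find_spec (hexι K)
  have hι_le : ∀ K, (F (ι K)).2 ≤ K := fun K => by
    by_cases h0 : ι K = 0
    · rw [h0, hT0]; exact Nat.zero_le _
    · obtain ⟨j, hj⟩ := Nat.exists_eq_succ_of_ne_zero h0
      have hmin := Nat.find_min (hexι K) (show j < ι K by omega)
      rw [hj]; exact not_lt.1 hmin
  have hι_mono : ∀ K, ι K ≤ ι (K + 1) := fun K =>
    Nat.find_mono (fun i (h : K + 1 < (F (i + 1)).2) => (Nat.lt_succ_self K).trans h)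
  have hι_block : ∀ i K, (F i).2 ≤ K → K < (F (i + 1)).2 → ι K = i := fun i K h1 h2 => by
    rw [show ι K = Nat.find (hexι K) from rfl, Nat.find_eq_iff]
    refine ⟨h2, fun j hj hK => ?_⟩
    have : (F (j + 1)).2 ≤ (F i).2 := hT_strict.monotone (a := j + 1) (b := i) (by omega)
    omega
  /- §D the chain -/
  set Λ : ℕ → Measure ℝ := fun K => if Even K then Pa (F (ι K)).1 else Qa (F (ι K)).1 with hΛ
  have hΛP : ∀ K, IsProbabilityMeasure (Λ K) := fun K => by
    simp only [hΛ]; split_ifs; exacts [iPa _ (hm3 _), iQa _ (hm3 _)]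
  have hΛc : ∀ K, Λ K (Set.Icc (-1 : ℝ) 1)ᶜ = 0 := fun K => by simp only [hΛ]; split_ifs; exacts [hPac _, hQac _]
  have hnear : ∀ (K : ℕ) (t : ℝ), |t| ≤ l₀ → |mgf id (Λ K) t - 1 / 2 * ∫ x in (-1 : ℝ)..1, Real.exp (t * x)| ≤ 2 * b (F (ι K)).1 :=
    fun K t ht => by
    simp only [hΛ]
    split_ifs
    · exact (hmgf _ (hm3 _) (hml _) t ht).1
    · exact (hmgf _ (hm3 _) (hml _) t ht).2
  /- §E the observable -/
  set c : ℝ → ℝ := fun t => max (min t 1) (-1) with hcdef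
  have hc_mem : ∀ t, c t ∈ Set.Icc (-1 : ℝ) 1 := fun t => ⟨le_max_right _ _, max_le (min_le_right _ _) (by norm_num)⟩
  have hc_id : ∀ t ∈ Set.Icc (-1 : ℝ) 1, c t = t := fun t ht => by simp only [hcdef, min_eq_left ht.2, max_eq_left ht.1]
  have hc_cont : Continuous c := (continuous_id.min continuous_const).max continuous_const
  set G : ℕ → ℝ → ℝ := fun j x => Gt (F j).1 (c x) with hGdef
  have hGjc : ∀ j, Continuous (G j) := fun j => (hGc _).comp hc_cont
  have hGjB : ∀ j x, |G j x| ≤ 1 := fun j x => by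
    have h := hGB _ (hm1 j) (c x) (hc_mem x)
    have hmr : (1 : ℝ) ≤ (F j).1 := by exact_mod_cast hm1 j
    exact h.trans (by rw [div_le_one (by positivity)]; linarith)
  have hGjL : ∀ (j : ℕ) (x y : ℝ), x ∈ Set.Icc (-1 : ℝ) 1 → y ∈ Set.Icc (-1 : ℝ) 1 → |G j x - G j y| ≤ 1 * |x - y| :=
    fun j x y hx hy => by simp only [hGdef, hc_id x hx, hc_id y hy]; exact hGL _ (hm1 j) x y hx hy
  set g : ℝ → ℝ := fun x => ∑' j : ℕ, (1 / 8 : ℝ) ^ (j + 1) * G j x with hgdef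
  refine ⟨Λ, hΛP, hΛc, ⟨fun K => ⟨0, fun t ht => ?_⟩, (summable_geometric_of_lt_one hθ0.le hθ1).mul_left C⟩, g,
    continuous_seriesTest hGjc hGjB, fun x y hx hy => (abs_seriesTest_sub_le hGjB hGjL hx hy).trans (by
      have := abs_nonneg (x - y); nlinarith), fun x _ => (abs_seriesTest_le hGjB x).trans (by norm_num), fun hSum => ?_⟩
  · /- §F matching modulo the constants `0` with the geometric remainder -/
    rw [sub_zero]
    change |cgf id (Λ (K + 1)) t - cgf id (Λ K) t| ≤ vol * (C * θ ^ K)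
    haveI := hΛP K
    haveI := hΛP (K + 1)
    have hlow : ∀ K, Real.exp (-l₀) ≤ mgf id (Λ K) t := fun K => by
      haveI := hΛP K
      exact exp_neg_le_mgf_id_of_Icc_symm (Λ K) (hΛc K) ht
    have hm : |mgf id (Λ (K + 1)) t - mgf id (Λ K) t| ≤ 4 * b (F (ι K)).1 := by
      have h1 := hnear K t ht
      have h2 := hnear (K + 1) t ht
      have h3 : b (F (ι (K + 1))).1 ≤ b (F (ι K)).1 := hb_mono _ _ (hm_ge _) (hm_mono _ _ (hι_mono K))
      calc |mgf id (Λ (K + 1)) t - mgf id (Λ K) t|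
          ≤ |mgf id (Λ (K + 1)) t - 1 / 2 * ∫ x in (-1 : ℝ)..1, Real.exp (t * x)| +
            |1 / 2 * (∫ x in (-1 : ℝ)..1, Real.exp (t * x)) - mgf id (Λ K) t| := abs_sub_le _ _ _
        _ = |mgf id (Λ (K + 1)) t - 1 / 2 * ∫ x in (-1 : ℝ)..1, Real.exp (t * x)| +
            |mgf id (Λ K) t - 1 / 2 * ∫ x in (-1 : ℝ)..1, Real.exp (t * x)| := by rw [abs_sub_comm (1 / 2 * _) _]
        _ ≤ 2 * b (F (ι (K + 1))).1 + 2 * b (F (ι K)).1 := add_le_add h2 h1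
        _ ≤ 4 * b (F (ι K)).1 := by linarith
    have hbud : 4 * Real.exp l₀ * b (F (ι K)).1 ≤ vol * (C * θ ^ K) := by
      have hθK : θ ^ (F (ι K + 1)).2 ≤ θ ^ K := pow_le_pow_of_le_one hθ0.le hθ1.le (hι_spec K).le
      calc 4 * Real.exp l₀ * b (F (ι K)).1 ≤ vol * C * θ ^ (F (ι K + 1)).2 := hcost (ι K)
        _ ≤ vol * C * θ ^ K := mul_le_mul_of_nonneg_left hθK (by positivity)
        _ = vol * (C * θ ^ K) := by ring
    calc |cgf id (Λ (K + 1)) t - cgf id (Λ K) t| = |Real.log (mgf id (Λ (K + 1)) t) - Real.log (mgf id (Λ K) t)| := by rw [cgf, cgf]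
      _ ≤ Real.exp l₀ * |mgf id (Λ (K + 1)) t - mgf id (Λ K) t| := abs_log_sub_log_le_of_exp_neg_le (hlow _) (hlow _)
      _ ≤ Real.exp l₀ * (4 * b (F (ι K)).1) := mul_le_mul_of_nonneg_left hm (Real.exp_pos _).le
      _ = 4 * Real.exp l₀ * b (F (ι K)).1 := by ring
      _ ≤ vol * (C * θ ^ K) := hbud
  · /- §G the increments inside block `i` are `≥ 8^{−(i+1)}∕(3m_i)`; blocks contribute `≥ ½` each -/
    -- the swap payment of the observable at level `m_i`
    have hswap : ∀ i, (1 / 8 : ℝ) ^ (i + 1) / (3 * (F i).1) ≤ |∫ x, g x ∂Pa (F i).1 - ∫ x, g x ∂Qa (F i).1| := by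
      intro i
      haveI := iPa _ (hm3 i)
      haveI := iQa _ (hm3 i)
      have hmr : (0 : ℝ) < (F i).1 := by exact_mod_cast hm1 i
      rw [hgdef, integral_seriesTest (Pa (F i).1) hGjc hGjB, integral_seriesTest (Qa (F i).1) hGjc hGjB]
      have hsP : Summable fun j : ℕ => (1 / 8 : ℝ) ^ (j + 1) * ∫ x, G j x ∂Pa (F i).1 :=
        Summable.of_norm_bounded summable_weights fun j => by
          rw [Real.norm_eq_abs, abs_mul, abs_of_pos (by positivity : (0 : ℝ) < (1 / 8 : ℝ) ^ (j + 1))]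
          exact mul_le_of_le_one_right (by positivity) (abs_integral_le_of_Icc_symm (hPac _) fun x _ => hGjB j x)
      have hsQ : Summable fun j : ℕ => (1 / 8 : ℝ) ^ (j + 1) * ∫ x, G j x ∂Qa (F i).1 :=
        Summable.of_norm_bounded summable_weights fun j => by
          rw [Real.norm_eq_abs, abs_mul, abs_of_pos (by positivity : (0 : ℝ) < (1 / 8 : ℝ) ^ (j + 1))]
          exact mul_le_of_le_one_right (by positivity) (abs_integral_le_of_Icc_symm (hQac _) fun x _ => hGjB j x)
      rw [← hsP.tsum_sub hsQ]
      simp_rw [← mul_sub]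
      -- the integrals of `G j` against the arc laws are those of the polynomial `Gt (m j)` (clamp = identity on the arcs)
      have hGint : ∀ (j : ℕ) (n : ℕ), ∫ x, G j x ∂Pa n - ∫ x, G j x ∂Qa n = ∫ x, Gt (F j).1 x ∂Pa n - ∫ x, Gt (F j).1 x ∂Qa n := by
        intro j n
        rw [hsub n (hGjc j), hsub n (hGc _)]
        refine Finset.sum_congr rfl fun k _ => ?_
        congr 1
        refine intervalIntegral.integral_congr fun x hx => ?_
        have hxI : x ∈ Set.Icc (-1 : ℝ) 1 := Set.uIcc_subset_Icc node_mem_Icc node_mem_Icc hx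
        simp only [hGdef, hc_id x hxI]
      simp_rw [hGint]
      refine lacunary_lower_bound hmr (fun j hj => hGkill _ _ (hm1 j) (hm_sep j i hj)) (hGpay _ (hm3 i)) fun j hj => ?_
      calc |∫ x, Gt (F j).1 x ∂Pa (F i).1 - ∫ x, Gt (F j).1 x ∂Qa (F i).1|
          ≤ |∫ x, Gt (F j).1 x ∂Pa (F i).1| + |∫ x, Gt (F j).1 x ∂Qa (F i).1| := abs_sub _ _
        _ ≤ 1 / (2 * (F j).1) + 1 / (2 * (F j).1) :=
            add_le_add (abs_integral_le_of_Icc_symm (hPac _) (hGB _ (hm1 j))) (abs_integral_le_of_Icc_symm (hQac _) (hGB _ (hm1 j)))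
        _ = 1 / (F j).1 := by field_simp; ring
        _ ≤ 1 / (F i).1 := one_div_le_one_div_of_le hmr (by exact_mod_cast hm_mono i j hj.le)
    -- an inner step of block `i` pays at least `8^{−(i+1)}∕(3m_i)`
    have hstep : ∀ i K, (F i).2 ≤ K → K + 1 < (F (i + 1)).2 →
        (1 / 8 : ℝ) ^ (i + 1) / (3 * (F i).1) ≤ |∫ x, g x ∂Λ (K + 1) - ∫ x, g x ∂Λ K| := by
      intro i K h1 h2
      have hιK : ι K = i := hι_block i K h1 (by omega)
      have hιK1 : ι (K + 1) = i := hι_block i (K + 1) (by omega) h2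
      rcases Nat.even_or_odd K with hK | hK
      · have h1' : ¬Even (K + 1) := Nat.not_even_iff_odd.2 hK.add_one
        simp only [hΛ, hK, if_true, h1', if_false, hιK, hιK1]
        rw [abs_sub_comm]; exact hswap i
      · have h0' : ¬Even K := Nat.not_even_iff_odd.2 hK
        have h1' : Even (K + 1) := hK.add_one
        simp only [hΛ, h0', if_false, h1', if_true, hιK, hιK1]
        exact hswap i
    -- block `i` contributes at least `½`
    have hblock : ∀ i, (1 / 2 : ℝ) ≤ ∑ K ∈ Finset.Ico (F i).2 (F (i + 1)).2, |∫ x, g x ∂Λ (K + 1) - ∫ x, g x ∂Λ K| := by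
      intro i
      have hmr : (0 : ℝ) < (F i).1 := by exact_mod_cast hm1 i
      have hm3r : (3 : ℝ) ≤ (F i).1 := by exact_mod_cast hm3 i
      have hsub' : Finset.Ico (F i).2 ((F (i + 1)).2 - 1) ⊆ Finset.Ico (F i).2 (F (i + 1)).2 :=
        Finset.Ico_subset_Ico_right (Nat.sub_le _ _)
      have hcard : (Finset.Ico (F i).2 ((F (i + 1)).2 - 1)).card = 3 * 8 ^ (i + 1) * (F i).1 - 1 := by
        rw [Nat.card_Ico, hTs i]; omega
      calc (1 / 2 : ℝ) ≤ ((3 * 8 ^ (i + 1) * (F i).1 - 1 : ℕ) : ℝ) * ((1 / 8 : ℝ) ^ (i + 1) / (3 * (F i).1)) := by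
            rw [Nat.cast_sub (Nat.succ_le_of_lt (Nat.mul_pos (by positivity) (hm1 i)))]
            push_cast
            rw [sub_mul, show (3 : ℝ) * 8 ^ (i + 1) * (F i).1 * ((1 / 8 : ℝ) ^ (i + 1) / (3 * (F i).1)) = 1 by
              field_simp; rw [← mul_pow]; norm_num]
            have : (1 : ℝ) * ((1 / 8 : ℝ) ^ (i + 1) / (3 * (F i).1)) ≤ 1 / 2 := by
              rw [one_mul, div_le_iff₀ (by positivity)]
              have h8 : (1 / 8 : ℝ) ^ (i + 1) ≤ 1 / 8 := by
                calc (1 / 8 : ℝ) ^ (i + 1) ≤ (1 / 8 : ℝ) ^ 1 := pow_le_pow_of_le_one (by norm_num) (by norm_num) (by omega)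
                  _ = 1 / 8 := pow_one _
              nlinarith
            linarith
        _ = ∑ K ∈ Finset.Ico (F i).2 ((F (i + 1)).2 - 1), (1 / 8 : ℝ) ^ (i + 1) / (3 * (F i).1) := by
            rw [Finset.sum_const, hcard, nsmul_eq_mul]
        _ ≤ ∑ K ∈ Finset.Ico (F i).2 ((F (i + 1)).2 - 1), |∫ x, g x ∂Λ (K + 1) - ∫ x, g x ∂Λ K| :=
            Finset.sum_le_sum fun K hK => by
              rw [Finset.mem_Ico] at hK
              exact hstep i K hK.1 (by omega)
        _ ≤ ∑ K ∈ Finset.Ico (F i).2 (F (i + 1)).2, |∫ x, g x ∂Λ (K + 1) - ∫ x, g x ∂Λ K| :=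
            Finset.sum_le_sum_of_subset_of_nonneg hsub' fun K _ _ => abs_nonneg _
    -- partial sums over `[0, T_n)` are `≥ n∕2`
    have hpartial : ∀ n : ℕ, (n : ℝ) / 2 ≤ ∑ K ∈ Finset.range (F n).2, |∫ x, g x ∂Λ (K + 1) - ∫ x, g x ∂Λ K| := by
      intro n
      induction n with
      | zero => rw [hT0]; simp
      | succ n ih =>
        rw [Finset.range_eq_Ico] at ih ⊢
        rw [← Finset.sum_Ico_consecutive _ (Nat.zero_le _) (hT_lt n).le]
        push_cast
        linarith [hblock n]
    -- contradiction with summability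
    set s : ℝ := ∑' K, |∫ x, g x ∂Λ (K + 1) - ∫ x, g x ∂Λ K| with hs
    have hle : ∀ n : ℕ, (n : ℝ) / 2 ≤ s := fun n =>
      (hpartial n).trans (hSum.sum_le_tsum (Finset.range (F n).2) fun K _ => abs_nonneg _)
    obtain ⟨n, hn⟩ := exists_nat_gt (2 * s)
    have := hle n
    linarith

end Summit.QuantumFields.YangMills.Theorems.BalabanUVNodesN19TargetFixedTestNotSummable

end
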